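import Literature.NumberTheory.Transcendental.ChartTransfer
import Literature.NumberTheory.Transcendental.ZilberFieldQuasiminimalProofs
import Literature.FieldTheory.Regular.RegularBaseChange
import Literature.NumberTheory.Transcendental.GammaAbsorption
import HarnessLib

/-!
# Point ideals over intermediate fields, descent of their generators, and strong hulls over
closed sets (toolkit for Bays–Kirby 2018, Thm 6.9, QM5b)

M. Bays, J. Kirby, *Pseudo-exponential maps, variants, and quasiminimality*, Algebra & Number
Theory 12 (2018), proof of Thm 6.9, axiom QM5b (non-splitting over a finite set): for a closed
countable `C` and a good basis `β` of the hull of `C ∪ b`, "choose `C₀` … such that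
`Loc(β, b/C)` is defined over `F_base(γ)`", "`Loc(β/A) = Loc(β/A') = V` because `V` is defined
over `F_base(γ)`", and "`⟨Aβ⟩ ◁ M` … because `β` is algebraically and linearly independent from
`C` over `A`". This file provides the field-theoretic content of these three sentences inside an
exponential field `M`, for the ideal of polynomial relations of a point over an intermediate
field:

* `SEACModel.ptIdeal L pt` — the ideal of `pt : ι → M` over `L` (prime);
* `SEACModel.ptIdeal_eq_map_of_coeffs` / `ptIdeal_eq_map_of_tower` — if the ideal over `L'` is
  generated by polynomials with coefficients in `L ≤ L'`, it is extended from the ideal over `L`,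
  and then from the ideal over every intermediate `L ≤ E ≤ L'` (faithful flatness,
  `Literature.FieldTheory.Regular.map_mem_map_iff`);
* `SEACModel.relRank_eq_of_ptIdeal_eq_map` — in that situation, if `L` is algebraically closed,
  the transcendence degree of the point is the same over `L` and over `L'` (linear disjointness,
  `ChartTransfer.trdeg_quotient_contract_eq`): "`β` is algebraically independent from `C` over
  `A`";
* `SEACModel.isStrong_sup_span_of_closed` — consequently the hull descends: if `H` is Γ-closed,
  `β` is linearly independent over `H` with `H + ℚβ ◁ M`, and the ideal of `(β, exp β)` over `H`
  is generated over the Γ-closed `X ≤ H`, then `X + ℚβ ◁ M` ("`⟨Aβ⟩ ◁ M`").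

## References

* M. Bays, J. Kirby, *Pseudo-exponential maps, variants, and quasiminimality*, Algebra & Number
  Theory 12 (2018) 493–549: Thm 6.9 (proof of QM5b), Lemma 4.2.
-/

noncomputable section

open Set MvPolynomial

universe u

namespace Literature.NumberTheory.Transcendental

namespace SEACModel

open GammaField Literature.ModelTheory.ExponentialFields.ExponentialRing

variable {M : Type u} [Field M] [CharZero M]

/-! ### Point ideals over intermediate fields -/

section PointIdeal

variable {ι : Type*}

/-- **The ideal of a point over an intermediate field**: the polynomials over `L` vanishing at
`pt` (for `pt = (β, exp β)` and `L` the field of a Γ-subfield this is the ideal of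
`Loc(β/L)`, Bays–Kirby 2018 §3.3). [cite: BaysKirby2018ANT, §3.3 (locus)] -/
def ptIdeal (L : IntermediateField ℚ M) (pt : ι → M) : Ideal (MvPolynomial ι L) :=
  RingHom.ker (MvPolynomial.aeval (R := L) pt).toRingHom

/-- Membership in the point ideal. [folklore] -/
theorem mem_ptIdeal_iff {L : IntermediateField ℚ M} {pt : ι → M} {p : MvPolynomial ι L} :
    p ∈ ptIdeal L pt ↔ aeval pt p = 0 :=
  RingHom.mem_ker

/-- Point ideals are prime. [folklore] -/
instance ptIdeal_isPrime (L : IntermediateField ℚ M) (pt : ι → M) : (ptIdeal L pt).IsPrime :=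
  RingHom.ker_isPrime _

/-- The algebra structure `L → L'` for `L ≤ L'`. [folklore] -/
abbrev inclAlgebra {L L' : IntermediateField ℚ M} (h : L ≤ L') : Algebra L L' :=
  (IntermediateField.inclusion h).toRingHom.toAlgebra

/-- The tower `L → L' → M`. [folklore] -/
theorem isScalarTower_incl {L L' : IntermediateField ℚ M} (h : L ≤ L') :
    letI := inclAlgebra h
    IsScalarTower L L' M :=
  letI := inclAlgebra h
  IsScalarTower.of_algebraMap_eq fun _ => rfl

/-- Over a larger field the point ideal contracts to the point ideal. [folklore] -/
theorem contract_ptIdeal {L L' : IntermediateField ℚ M} (h : L ≤ L') (pt : ι → M) :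
    letI := inclAlgebra h
    ChartTransfer.contract (M := L) (ptIdeal L' pt) = ptIdeal L pt := by
  letI := inclAlgebra h
  haveI := isScalarTower_incl h
  ext p
  rw [ChartTransfer.mem_contract_iff, mem_ptIdeal_iff, mem_ptIdeal_iff, aeval_map_algebraMap]

/-- The point ideal over `L` extends into the point ideal over `L' ≥ L`. [folklore] -/
theorem map_ptIdeal_le {L L' : IntermediateField ℚ M} (h : L ≤ L') (pt : ι → M) :
    letI := inclAlgebra h
    (ptIdeal L pt).map (MvPolynomial.map (algebraMap L L')) ≤ ptIdeal L' pt := by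
  letI := inclAlgebra h
  haveI := isScalarTower_incl h
  refine Ideal.map_le_iff_le_comap.2 fun p hp => ?_
  rw [Ideal.mem_comap, mem_ptIdeal_iff, aeval_map_algebraMap]
  exact mem_ptIdeal_iff.1 hp

/-- **Descent of the point ideal to the field of its coefficients**: if the point ideal over `L'`
is generated by finitely many polynomials all of whose coefficients lie in `L ≤ L'`, then it is
the extension of the point ideal over `L`. [cite: BaysKirby2018ANT, Thm 6.9 (proof of QM5b:
"`Loc(β, b/C)` is defined over `F_base(γ)`")] -/
theorem ptIdeal_eq_map_of_coeffs {L L' : IntermediateField ℚ M} (h : L ≤ L') (pt : ι → M)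
    (T : Finset (MvPolynomial ι L')) (hT : ptIdeal L' pt = Ideal.span (T : Set (MvPolynomial ι L')))
    (hcoef : ∀ t ∈ T, ∀ c ∈ t.coeffs, (c : M) ∈ L) :
    letI := inclAlgebra h
    ptIdeal L' pt = (ptIdeal L pt).map (MvPolynomial.map (algebraMap L L')) := by
  letI := inclAlgebra h
  haveI := isScalarTower_incl h
  refine le_antisymm ?_ (map_ptIdeal_le h pt)
  rw [hT, Ideal.span_le]
  intro t ht
  -- `t` lifts to `L[X]`
  have hlift : ∃ q : MvPolynomial ι L, MvPolynomial.map (algebraMap L L') q = t := by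
    change t ∈ Set.range (MvPolynomial.map (algebraMap L L'))
    rw [mem_range_map_iff_coeffs_subset]
    intro c hc
    exact ⟨⟨c, hcoef t ht c (Finset.mem_coe.1 hc)⟩, Subtype.ext rfl⟩
  obtain ⟨q, rfl⟩ := hlift
  refine Ideal.mem_map_of_mem _ (mem_ptIdeal_iff.2 ?_)
  have ht' : MvPolynomial.map (algebraMap L L') q ∈ ptIdeal L' pt := by
    rw [hT]; exact Ideal.subset_span ht
  rw [mem_ptIdeal_iff, aeval_map_algebraMap] at ht'
  exact ht'

/-- **Intermediate descent**: if the point ideal over `L'` is extended from the one over `F₁`,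
then for every intermediate `F₁ ≤ L ≤ L'` the point ideal over `L` is extended from the one over
`F₁` (faithful flatness of `L'[X]` over `L[X]`, `Literature.FieldTheory.Regular.map_mem_map_iff`).
[cite: BaysKirby2018ANT, Thm 6.9 (proof of QM5b: "`Loc(β/A) = Loc(β/A') = V`")] -/
theorem ptIdeal_eq_map_of_tower {F₁ L L' : IntermediateField ℚ M} (h₁ : F₁ ≤ L) (h₂ : L ≤ L')
    (pt : ι → M)
    (hdef : letI := inclAlgebra (h₁.trans h₂)
      ptIdeal L' pt = (ptIdeal F₁ pt).map (MvPolynomial.map (algebraMap F₁ L'))) :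
    letI := inclAlgebra h₁
    ptIdeal L pt = (ptIdeal F₁ pt).map (MvPolynomial.map (algebraMap F₁ L)) := by
  letI := inclAlgebra h₁
  letI := inclAlgebra h₂
  letI := inclAlgebra (h₁.trans h₂)
  haveI := isScalarTower_incl h₂
  refine le_antisymm (fun q hq => ?_) (map_ptIdeal_le h₁ pt)
  -- `q` maps into the ideal over `L'`, which is extended from `F₁` through `L`
  have hcomp : (MvPolynomial.map (σ := ι) (algebraMap L L')).comp
      (MvPolynomial.map (σ := ι) (algebraMap F₁ L)) = MvPolynomial.map (algebraMap F₁ L') :=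
    RingHom.ext fun p => by rw [RingHom.comp_apply, MvPolynomial.map_map]; rfl
  have hmap : ((ptIdeal F₁ pt).map (MvPolynomial.map (algebraMap F₁ L))).map
      (MvPolynomial.map (algebraMap L L')) = ptIdeal L' pt := by
    rw [Ideal.map_map, hcomp, ← hdef]
  have hq' : MvPolynomial.map (algebraMap L L') q ∈ ptIdeal L' pt := by
    rw [mem_ptIdeal_iff, aeval_map_algebraMap]; exact mem_ptIdeal_iff.1 hq
  rw [← hmap] at hq'
  exact (Literature.FieldTheory.Regular.map_mem_map_iff _ q).1 hq'

/-- Points of the point ideal over `L` are points of the extended ideal over `L'`. [folklore] -/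
theorem mem_zeroLocus_of_ptIdeal_eq_map {L L' : IntermediateField ℚ M} (h : L ≤ L') (pt : ι → M)
    (hdef : letI := inclAlgebra h
      ptIdeal L' pt = (ptIdeal L pt).map (MvPolynomial.map (algebraMap L L')))
    (m : ι → L) (hm : m ∈ zeroLocus L (ptIdeal L pt)) :
    letI := inclAlgebra h
    (algebraMap L L' ∘ m) ∈ zeroLocus L' (ptIdeal L' pt) := by
  letI := inclAlgebra h
  intro p hp
  rw [hdef] at hp
  refine Submodule.span_induction ?_ ?_ ?_ ?_ hp
  · rintro _ ⟨q, hq, rfl⟩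
    change aeval (algebraMap L L' ∘ m) (MvPolynomial.map (algebraMap L L') q) = 0
    rw [aeval_map_algebraMap, ChartTransfer.aeval_algebraMap_comp, hm q hq, map_zero]
  · exact map_zero _
  · intro x y _ _ hx hy; rw [map_add, hx, hy, add_zero]
  · intro a x _ hx; rw [smul_eq_mul, map_mul, hx, mul_zero]

/-- **The transcendence degree of the point does not drop** from an algebraically closed `L` to
`L' ≥ L` when the point ideal over `L'` is extended from `L` (linear disjointness,
`ChartTransfer.trdeg_quotient_contract_eq`): in the algebraic matroid of `M`,
`rk(pt/L) = rk(pt/L')`. [cite: BaysKirby2018ANT, Thm 6.9 (proof of QM5b: "`β` is algebraically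
… independent from `C` over `A`")] -/
theorem relRank_eq_of_ptIdeal_eq_map [Finite ι] {L L' : IntermediateField ℚ M} (h : L ≤ L')
    [IsAlgClosed L] (pt : ι → M)
    (hdef : letI := inclAlgebra h
      ptIdeal L' pt = (ptIdeal L pt).map (MvPolynomial.map (algebraMap L L'))) :
    (algMatroid M).relRank (L : Set M) (range pt) = (algMatroid M).relRank (L' : Set M) (range pt) := by
  classical
  letI := inclAlgebra h
  haveI := isScalarTower_incl h
  haveI : Fintype ι := Fintype.ofFinite ι
  -- both relative ranks are transcendence degrees of the coordinate rings
  have e1 : ∀ E : IntermediateField ℚ M, (algMatroid M).relRank (E : Set M) (range pt) =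
      Cardinal.toENat (Algebra.trdeg E (MvPolynomial ι E ⧸ ptIdeal E pt)) := by
    intro E
    rw [← ZilberSaturationMain.toENat_trdeg_algebra_adjoin_eq_relRank]
    have hsurj : Function.Surjective (MvPolynomial.aeval (R := E) pt).rangeRestrict :=
      AlgHom.rangeRestrict_surjective _
    have hker : RingHom.ker (MvPolynomial.aeval (R := E) pt).rangeRestrict.toRingHom = ptIdeal E pt := by
      ext p
      rw [RingHom.mem_ker, mem_ptIdeal_iff]
      change (MvPolynomial.aeval (R := E) pt).rangeRestrict p = 0 ↔ _
      rw [← Subtype.coe_inj, ZeroMemClass.coe_zero]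
      exact Iff.rfl
    have equ : (MvPolynomial ι E ⧸ ptIdeal E pt) ≃ₐ[E] (MvPolynomial.aeval (R := E) pt).range := by
      rw [← hker]
      exact Ideal.quotientKerAlgEquivOfSurjective hsurj
    rw [Algebra.adjoin_range_eq_range_aeval]
    have hl := AlgEquiv.lift_trdeg_eq (R := E) (A := MvPolynomial ι E ⧸ ptIdeal E pt)
      (A' := (MvPolynomial.aeval (R := E) pt).range) equ
    apply_fun Cardinal.toENat at hl
    simpa only [Cardinal.toENat_lift] using hl.symm
  rw [e1, e1]
  congr 1
  have hpts : ∀ m : ι → L, m ∈ zeroLocus L (ChartTransfer.contract (M := L) (ptIdeal L' pt)) →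
      (algebraMap L L' ∘ m) ∈ zeroLocus L' (ptIdeal L' pt) := by
    intro m hm
    rw [contract_ptIdeal h] at hm
    exact mem_zeroLocus_of_ptIdeal_eq_map h pt hdef m hm
  have := ChartTransfer.trdeg_quotient_contract_eq (M := L) (ptIdeal L' pt) hpts
  rwa [contract_ptIdeal h] at this

end PointIdeal

/-! ### Γ-closed fields are algebraically closed -/

section GammaClosed

variable [Literature.ModelTheory.ExponentialFields.ExponentialRing M]

/-- **The Γ-field of a Γ-closed subspace of an algebraically closed field is algebraically
closed** (it is relatively algebraically closed: Bays–Kirby 2018, Def. 4.9 and Lemma 4.10; "closed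
⟹ full"). [cite: BaysKirby2018ANT, Lemma 4.10] -/
theorem isAlgClosed_fieldOf [IsAlgClosed M] {K : Submodule ℚ M} (hK : IsGammaClosed K) :
    IsAlgClosed (fieldOf K) := by
  refine IsAlgClosed.of_exists_root _ fun p hmonic hirr => ?_
  have hdeg : p.degree ≠ 0 := by
    intro h0
    exact hirr.not_isUnit (Polynomial.isUnit_iff_degree_eq_zero.2 h0)
  obtain ⟨z, hz⟩ := IsAlgClosed.exists_aeval_eq_zero M p hdeg
  have halg : IsAlgebraic (fieldOf K) z := ⟨p, hmonic.ne_zero, hz⟩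
  have hzacl : z ∈ acl ((fieldOf K : Set M)) :=
    ZilberHomogeneity.mem_acl_of_isAlgebraic (fieldOf K).toSubalgebra halg
  rw [acl_fieldOf] at hzacl
  have hzK : z ∈ fieldOf K := mem_fieldOf_of_mem (hK.mem_of_mem_acl hzacl)
  refine ⟨⟨z, hzK⟩, ?_⟩
  have : (algebraMap (fieldOf K) M) (Polynomial.eval ⟨z, hzK⟩ p) = 0 := by
    rw [← Polynomial.aeval_algebraMap_apply_eq_algebraMap_eval]; exact hz
  exact (map_eq_zero_iff _ (algebraMap (fieldOf K) M).injective).1 this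

end GammaClosed

/-! ### Strong hulls descend to closed subfields of definition -/

section Hull

variable [Literature.ModelTheory.ExponentialFields.ExponentialRing M]

/-- `td(Λ + ℚβ / Λ)` is the relative rank of `(β, exp β)` over the Γ-field of `Λ`. [folklore] -/
theorem td_span_eq_relRank_fieldOf (Λ : Submodule ℚ M) {n : ℕ} (β : Fin n → M) :
    td Λ (Submodule.span ℚ (range β)) = (algMatroid M).relRank (fieldOf Λ : Set M) (range (gammaPt β)) := by
  have h := ZilberGSGC.relRank_fieldOf_union_range_gammaPt Λ (Fin.elim0 : Fin 0 → M) β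
  have e1 : range (gammaPt (Fin.elim0 : Fin 0 → M)) = ∅ := range_eq_empty _
  have e2 : range (Fin.elim0 : Fin 0 → M) = ∅ := range_eq_empty _
  rw [e1, union_empty, e2, Submodule.span_empty, sup_bot_eq] at h
  exact h.symm

/-- **The hull descends** (Bays–Kirby 2018, proof of Thm 6.9, QM5b: "`⟨Aβ⟩ ◁ B` … because `β` is
algebraically and linearly independent from `C` over `A` … Since `B ◁ M` we have `⟨Aβ⟩ ◁ M`").
Let `K_X ≤ K_H` be Γ-closed (hence strong), `β` linearly independent over `K_H` with
`K_H + ℚβ ◁ M`, and suppose `td(β, exp β / K_X) = td(β, exp β / K_H)`. Then `K_X + ℚβ ◁ M`.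
Proof: for `Z ⊇ K_X + ℚβ` finitely generated, `δ(Z/K_X + ℚβ) = δ(Z/Z ∩ B) + δ(Z ∩ B/K_X + ℚβ)`
with `B = K_H + ℚβ`; the first term is `≥ δ(Z + B/B) ≥ 0` (submodularity, `B ◁ M`); and
`Z ∩ B = Z₂ ⊕ ℚβ` with `Z₂ = Z ∩ B ∩ K_H`, whence `δ(Z ∩ B/K_X + ℚβ) = δ(Z₂/K_X) ≥ 0` by the
transcendence hypothesis (`td` over `Z₂` is squeezed between `td` over `K_X` and over `K_H`).
[cite: BaysKirby2018ANT, Thm 6.9 (proof of QM5b)] -/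
theorem isStrong_sup_span_of_td_eq {KX KH : Submodule ℚ M} (hKX : IsStrong KX) (hle : KX ≤ KH)
    {n : ℕ} {β : Fin n → M} (hβ : LinIndepOver KH β)
    (hB : IsStrong (KH ⊔ Submodule.span ℚ (range β)))
    (htd : td KX (Submodule.span ℚ (range β)) = td KH (Submodule.span ℚ (range β))) :
    IsStrong (KX ⊔ Submodule.span ℚ (range β)) := by
  classical
  set Sβ := Submodule.span ℚ (range β) with hSβ
  set Y₀ := KX ⊔ Sβ with hY₀def
  set B := KH ⊔ Sβ with hBdef
  have hY₀B : Y₀ ≤ B := sup_le_sup_right hle _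
  intro Z hYZ hfg
  -- split along `Y₀ ≤ Z ⊓ B ≤ Z`
  have h1 : Y₀ ≤ Z ⊓ B := le_inf hYZ hY₀B
  have hadd := predim_add h1 (inf_le_left : Z ⊓ B ≤ Z) hfg
  -- the second term
  have hfgZB : IsFG (Z ⊓ B) Z := hfg.of_le_left h1
  have hsub : predim B (Z ⊔ B) ≤ predim (Z ⊓ B) Z := predim_sup_le Z B hfgZB
  have hBZ : 0 ≤ predim B (Z ⊔ B) :=
    hB le_sup_right (isFG_sup_right.2 ((isFG_iff_isFG_inf Z B).2 hfgZB))
  -- the first term: `Z₁ = Z ⊓ B = Z₂ ⊕ ℚβ`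
  set Z₁ := Z ⊓ B with hZ₁def
  set Z₂ := Z₁ ⊓ KH with hZ₂def
  have hKXZ₂ : KX ≤ Z₂ := le_inf (le_sup_left.trans h1) hle
  have hZ₂KH : Z₂ ≤ KH := inf_le_right
  have hSβZ₁ : Sβ ≤ Z₁ := le_sup_right.trans h1
  have hZ₁eq : Z₁ = Z₂ ⊔ Sβ := by
    refine le_antisymm (fun z hz => ?_) (sup_le inf_le_left hSβZ₁)
    have hzB : z ∈ B := (inf_le_right : Z₁ ≤ B) hz
    obtain ⟨h, hh, w, hw, rfl⟩ := Submodule.mem_sup.1 hzB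
    have hhZ₁ : h ∈ Z₁ := by
      have : h + w - w ∈ Z₁ := Z₁.sub_mem hz (hSβZ₁ hw)
      rwa [add_sub_cancel_right] at this
    exact Submodule.mem_sup.2 ⟨h, ⟨hhZ₁, hh⟩, w, hw, rfl⟩
  have hβZ₂ : LinIndepOver Z₂ β := hβ.of_le hZ₂KH
  have hβKX : LinIndepOver KX β := hβ.of_le hle
  -- finite generation
  have hfgY₀Z₁ : IsFG Y₀ Z₁ := hfg.mono inf_le_left
  have hfgKXY₀ : IsFG KX Y₀ := isFG_sup_left.2 (isFG_span_of_finite KX (finite_range β))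
  have hfgKXZ₁ : IsFG KX Z₁ := hfgKXY₀.trans hfgY₀Z₁
  have hfgKXZ₂ : IsFG KX Z₂ := hfgKXZ₁.mono inf_le_left
  -- linear dimensions
  have hl1 := ldim_add hKXZ₂ (inf_le_left : Z₂ ≤ Z₁) hfgKXZ₁
  have hl2 : ldim KX Z₁ = ldim KX Y₀ + ldim Y₀ Z₁ := ldim_add le_sup_left h1 hfgKXZ₁
  have hlZ : ldim Z₂ Z₁ = n := by
    rw [hZ₁eq, ldim_sup_left, ldim_span_eq_of_linIndepOver hβZ₂]
  have hlY : ldim KX Y₀ = n := by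
    rw [hY₀def, ldim_sup_left, ldim_span_eq_of_linIndepOver hβKX]
  have hldim : ldim Y₀ Z₁ = ldim KX Z₂ := by omega
  -- transcendence degrees
  have ht1 := td_add hKXZ₂ (inf_le_left : Z₂ ≤ Z₁)
  have ht2 : td KX Z₁ = td KX Y₀ + td Y₀ Z₁ := td_add le_sup_left h1
  have htZ : td Z₂ Z₁ = td KX Sβ := by
    rw [hZ₁eq, td_sup_left]
    refine le_antisymm (td_anti Sβ hKXZ₂) ?_
    rw [htd]
    exact td_anti Sβ hZ₂KH
  have htY : td KX Y₀ = td KX Sβ := by rw [hY₀def, td_sup_left]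
  have hfin : td KX Sβ ≠ ⊤ := td_ne_top (isFG_span_of_finite KX (finite_range β))
  have htdeq : td Y₀ Z₁ = td KX Z₂ := by
    have : td KX Sβ + td Y₀ Z₁ = td KX Sβ + td KX Z₂ := by
      rw [← htY, ← ht2, ht1, htZ, add_comm, htY]
    exact WithTop.add_left_cancel hfin this
  -- assemble
  have hfirst : predim Y₀ Z₁ = predim KX Z₂ := by
    rw [predim_def, predim_def, htdeq, hldim]
  have hKXZ₂' : 0 ≤ predim KX Z₂ := hKX hKXZ₂ hfgKXZ₂
  rw [hadd]
  linarith

end Hull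

end SEACModel

end Literature.NumberTheory.Transcendental
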